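import Summits.Parity.GeneralizedHardyLittlewood.Theorems.ChenParityOracleBLAPParityOracleChenTools
import HarnessLib

/-!
# Route `ChenParityOracleBLAP` — crux `ParityOracleChen` (stmt-Parity-20046): estimate (C′)

Support file 4/5: the UPPER bound for the parity subset `B′(x) = {b ∈ B(x) : λ(b) = −1}` of Chen's
switched set `B(x) = {p₁p₂p₃ − 2}`: `S(B′(x), (x+3)^{1/3}) ≤ (c e^γ/4 + ε)(x/log x)V(x^{1/8})` for large
`x`, under the oracle hypothesis `∑_{d ≤ x^{1/2−ε}} |∑_{b ∈ B(x), d∣b} λ(b)| = o(x/(log x)²)` (the route's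
HP2, verbatim). This is the tree's PROVED estimate (C) `Literature.NumberTheory.Sieve.Chen.twin_sieveUpperB_holds`
(Nathanson Thm 10.6 for `{p + 2}`: sieve step `roughCount_chenSetB_le`, remainder
`chenRemainderExt_bound`, cardinality `chenTriplesExt_card_bound`) with the main term halved. The
point of the twisted form `Iwaniec1980_twisted_upper_of_half_lt` here: the enlargement `B ⊆ B̃`
(Nathanson (10.13)–(10.14)) is applied to the UNSIGNED half only (`2b + e = 1_B ≤ ã`), so the oracle is
needed on the sharp set `B(x)` — exactly HP2 — and not on `B̃`.

References: [Nathanson1996] Thm 10.6; [ChenSciSinica1973] p. 176; [IwaniecActaArith1980] Thm 1.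
-/

namespace Summit.Parity.GeneralizedHardyLittlewood.Theorems

open Finset Filter Topology
open scoped ArithmeticFunction.Moebius ArithmeticFunction.Omega
open Literature.NumberTheory.Sieve Literature.NumberTheory.Sieve.Chen
  Literature.NumberTheory.Sieve.ChenSieve Literature.NumberTheory.Sieve.SieveSequence

/-- `B(x) ⊆ (0, 2x + 4]`: an element `p₁p₂p₃ − 2` has `8 ≤ p₁p₂p₃ ≤ x + 2`. -/
theorem chenSetB_subset_Ioc (x : ℕ) : chenSetB x ⊆ Finset.Ioc 0 (2 * x + 4) := by
  intro m hm
  obtain ⟨p₁, p₂, p₃, h₁, h₂, h₃, -, -, -, -, hle, rfl⟩ := mem_chenSetB.mp hm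
  have a := h₁.two_le; have b := h₂.two_le; have c := h₃.two_le
  have h8 : 8 ≤ p₁ * p₂ * p₃ := by
    calc 8 = 2 * 2 * 2 := by norm_num
      _ ≤ p₁ * p₂ * p₃ := by gcongr
  rw [Finset.mem_Ioc]
  omega

/-- **`B ⊆ B̃` pointwise**: the indicator of `B(x)` is dominated by the weights of the enlarged
switched sequence, `1_{B(x)}(n) ≤ #{t ∈ T̃(x, ε) : p₁p₂p₃ − 2 = n}` (a triple of `B(x)` lies in `T̃`
since `ℓ(p₁) ≤ p₁`; cf. the tree's `Chen.roughCount_chenSetB_le_card`). -/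
theorem indicator_chenSetB_le_chenWeightExt {x : ℕ} {ε : ℝ} (hx : 0 < x) (hε : 0 < ε) (n : ℕ) :
    (if n ∈ chenSetB x then (1 : ℝ) else 0) ≤ chenWeightExt x ε n := by
  classical
  by_cases hn : n ∈ chenSetB x
  swap
  · rw [if_neg hn]; exact Nat.cast_nonneg _
  rw [if_pos hn, chenWeightExt]
  obtain ⟨p₁, p₂, p₃, h₁, h₂, h₃, hz, hy, hy', h23, hle, rfl⟩ := mem_chenSetB.mp hn
  have hmem : (p₁, p₂, p₃) ∈ (chenTriplesExt x ε).filter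
      (fun t : ℕ × ℕ × ℕ => t.1 * t.2.1 * t.2.2 - 2 = p₁ * p₂ * p₃ - 2) := by
    rw [Finset.mem_filter, mem_chenTriplesExt]
    have a := h₁.two_le; have b := h₂.two_le; have c := h₃.two_le
    have hp₁ : p₁ ≤ p₁ * p₂ * p₃ := by
      calc p₁ = p₁ * 1 * 1 := by ring
        _ ≤ p₁ * p₂ * p₃ := by gcongr <;> omega
    have hp₂ : p₂ ≤ p₁ * p₂ * p₃ := by
      calc p₂ = 1 * p₂ * 1 := by ring
        _ ≤ p₁ * p₂ * p₃ := by gcongr <;> omega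
    have hp₃ : p₃ ≤ p₁ * p₂ * p₃ := by
      calc p₃ = 1 * 1 * p₃ := by ring
        _ ≤ p₁ * p₂ * p₃ := by gcongr <;> omega
    have hgrid : chenGridPoint x ε p₁ * p₂ * p₃ ≤ (x : ℝ) + 2 := by
      have hℓ := chenGridPoint_le hx hε (twinZ_le_iff.mp hz)
      have hℓ0 := (chenGridPoint_pos hx hε p₁).le
      calc chenGridPoint x ε p₁ * p₂ * p₃ ≤ (p₁ : ℝ) * p₂ * p₃ := by gcongr
        _ = ((p₁ * p₂ * p₃ : ℕ) : ℝ) := by push_cast; ring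
        _ ≤ ((x + 2 : ℕ) : ℝ) := by exact_mod_cast hle
        _ = (x : ℝ) + 2 := by push_cast; ring
    refine ⟨⟨⟨?_, ?_, ?_⟩, h₁, h₂, h₃, hz, hy, hy', h23, hgrid⟩, rfl⟩
    · show p₁ < 2 * x + 5
      omega
    · show p₂ < 2 * x + 5
      omega
    · show p₃ < 2 * x + 5
      omega
  have h1 : 1 ≤ #((chenTriplesExt x ε).filter
      (fun t : ℕ × ℕ × ℕ => t.1 * t.2.1 * t.2.2 - 2 = p₁ * p₂ * p₃ - 2)) :=
    Finset.card_pos.mpr ⟨_, hmem⟩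
  exact_mod_cast h1

set_option maxHeartbeats 400000 in
/-- **The sieve step of (C′)** (the tree's `Chen.roughCount_chenSetB_le` with the parity oracle): for
`0 < ε ≤ 1`, `0 < δ ≤ 1/8`, `θ > 0` and all large `x`, with `y = ⌈(x+3)^{1/3}⌉`, `z = x^{1/8}`,
`B′(x) = {b ∈ B(x) : λ(b) = −1}`,
`S(B′(x), y) ≤ ½((e^γ/(2(1 − 2δ)) + θ) · #T̃(x, ε) · V(z) + R(x, ε, x^{1/2−δ}))
  + ½ ∑_{d < x^{1/2−δ}, d ∣ P(y)} |∑_{b ∈ B(x), d ∣ b} λ(b)|`.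
Proof: the twisted upper bound `Iwaniec1980_twisted_upper_of_half_lt` for the enlarged sequence `𝒜̃`
(`chenSeqExt`) with `b = ½ 1_B (1 − λ)`, `e = 1_B λ` — admissible because `2b + e = 1_B ≤ ã`
(`indicator_chenSetB_le_chenWeightExt`) — so the oracle is needed on the SHARP set `B(x)` only; the
main term is then handled exactly as in the tree (`F₁(s) = 2e^γ/s`, `V(y) ≤ V(z)(log z/log y)e^{50/log z}`). -/
theorem roughCount_chenParityB_le {ε δ θ : ℝ} (hε : 0 < ε) (hε1 : ε ≤ 1) (hδ : 0 < δ) (hδ1 : δ ≤ 1 / 8)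
    (hθ : 0 < θ) :
    ∀ᶠ x : ℕ in atTop,
      (roughCount ((chenSetB x).filter fun n => ArithmeticFunction.liouville n = -1) (twinY x) : ℝ) ≤
        (1 / 2) * ((Real.exp Real.eulerMascheroniConstant / (2 * (1 - 2 * δ)) + θ) *
            #(chenTriplesExt x ε) * sieveProduct 2 ((x : ℝ) ^ (1 / 8 : ℝ)) +
          chenRemainderExt x ε ((x : ℝ) ^ (1 / 2 - δ))) +
        (1 / 2) * ∑ d ∈ (Finset.range ⌈(x : ℝ) ^ (1 / 2 - δ)⌉₊).filter
            (· ∣ primesProdBelow (twinY x : ℝ)),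
          |∑ b ∈ (chenSetB x).filter (fun b => d ∣ b), (ArithmeticFunction.liouville b : ℝ)| := by
  -- Iwaniec's Theorem 1 (twisted), `κ = 1`, for the dimension class of `g = 1/φ`
  obtain ⟨B, hB, hC⟩ := Iwaniec1980_twisted_upper_of_half_lt (κ := 1) (by norm_num)
  have hdim : HasIwaniecDimension (shiftedPrimesDensity 2) 1 (54 * Real.exp (54 / Real.log 2)) :=
    hasIwaniecDimension_shiftedPrimesDensity_two
  obtain ⟨CI, hCI⟩ := hC (54 * Real.exp (54 / Real.log 2))
  have hFeq : Set.EqOn B.1 (iwaniecUpperSieveFun 1) (Set.Ioi 0) := hB.eqOn_iwaniecSieveFun.1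
  set G := Real.exp Real.eulerMascheroniConstant with hG
  have hG0 : 0 < G := Real.exp_pos _
  set K := G / (2 * (1 - 2 * δ)) with hK
  have h12δ : 0 < 1 - 2 * δ := by linarith
  have hK0 : 0 ≤ K := by positivity
  have ha : 0 < 1 / 2 - δ := by linarith
  filter_upwards [eventually_ge_atTop 6561,
    eventually_twinY_le_rpow (show (3 : ℝ) / 8 ≤ 1 / 2 - δ by linarith),
    eventually_sieveFactor_le K (max CI 0) hθ ha] with x hx hYD hfac
  -- basic quantities
  have hxpos : 0 < x := by omega
  have hx1 : (1 : ℝ) < x := by exact_mod_cast (show 1 < x by omega)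
  have hx0 : (0 : ℝ) < x := by linarith
  have hlogx : 0 < Real.log x := Real.log_pos hx1
  have hL0 : Real.log (x : ℝ) ≠ 0 := hlogx.ne'
  set zr : ℝ := (x : ℝ) ^ (1 / 8 : ℝ) with hzr
  have hzr3 : 3 ≤ zr := by
    rw [hzr, show (3 : ℝ) = ((3 : ℝ) ^ (8 : ℕ)) ^ (1 / 8 : ℝ) by
      rw [← Real.rpow_natCast, ← Real.rpow_mul (by norm_num)]; norm_num]
    exact Real.rpow_le_rpow (by norm_num) (by exact_mod_cast hx) (by norm_num)
  have hlogzr : Real.log zr = 1 / 8 * Real.log x := Real.log_rpow hx0 _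
  set Y : ℝ := (twinY x : ℝ) with hY
  have hx13 : (x : ℝ) ^ (1 / 3 : ℝ) ≤ Y := by
    calc (x : ℝ) ^ (1 / 3 : ℝ) ≤ ((x : ℝ) + 3) ^ (1 / 3 : ℝ) :=
          Real.rpow_le_rpow hx0.le (by linarith) (by norm_num)
      _ ≤ Y := Nat.le_ceil _
  have hzY : zr ≤ Y :=
    le_trans (Real.rpow_le_rpow_of_exponent_le hx1.le (by norm_num)) hx13
  have hY2 : 2 ≤ Y := by linarith
  have hlogY : 1 / 3 * Real.log x ≤ Real.log Y := by
    have h := Real.log_le_log (Real.rpow_pos_of_pos hx0 _) hx13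
    rwa [Real.log_rpow hx0] at h
  have hlogY0 : 0 < Real.log Y := by linarith [mul_pos (by norm_num : (0 : ℝ) < 1 / 3) hlogx]
  have hLY0 : Real.log Y ≠ 0 := hlogY0.ne'
  set D : ℝ := (x : ℝ) ^ (1 / 2 - δ) with hD
  have hlogD : Real.log D = (1 / 2 - δ) * Real.log x := Real.log_rpow hx0 _
  have hlogD0 : 0 < Real.log D := by rw [hlogD]; positivity
  have hs0 : 0 < Real.log D / Real.log Y := div_pos hlogD0 hlogY0
  have hs3 : Real.log D / Real.log Y ≤ 3 := by
    rw [div_le_iff₀ hlogY0, hlogD]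
    nlinarith [mul_nonneg hδ.le hlogx.le]
  -- the twisted sieve inequality for `𝒜̃`
  set A := chenSeqExt x ε with hA
  set H : ℝ := ((2 * x + 4 : ℕ) : ℝ) with hH
  have hsize : (0 : ℝ) ≤ A.size H := Nat.cast_nonneg _
  set ind : ℕ → ℝ := fun n => if n ∈ chenSetB x then (1 : ℝ) else 0 with hind
  have hb : ∀ n, 0 ≤ (ind n - ind n * (ArithmeticFunction.liouville n : ℝ)) / 2 := fun n => by
    have h1 := abs_liouville_le_one n
    have h0 : 0 ≤ ind n := by simp only [hind]; split_ifs <;> norm_num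
    have : ind n * (ArithmeticFunction.liouville n : ℝ) ≤ ind n * 1 :=
      mul_le_mul_of_nonneg_left (le_of_abs_le h1) h0
    linarith
  have hbe : ∀ n, 2 * ((ind n - ind n * (ArithmeticFunction.liouville n : ℝ)) / 2) +
      ind n * (ArithmeticFunction.liouville n : ℝ) ≤ A.a n := fun n => by
    have := indicator_chenSetB_le_chenWeightExt hxpos hε n (ε := ε)
    change _ ≤ chenWeightExt x ε n
    simp only [hind] at this ⊢
    linarith
  have hI := hCI A hdim _ _ hb hbe H D Y hY2 hYD hsize
  -- identify the terms
  have hsift : ∑ n ∈ (Finset.Ioc 0 ⌊H⌋₊).filter (fun n : ℕ => n.Coprime (primesProdBelow Y)),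
      (ind n - ind n * (ArithmeticFunction.liouville n : ℝ)) / 2 =
      (roughCount ((chenSetB x).filter fun n => ArithmeticFunction.liouville n = -1) (twinY x) : ℝ) := by
    rw [hH, hY, twistedSifted_indicator_eq (chenSetB x) (chenSetB_subset_Ioc x), Nat.ceil_natCast]
  have hE : ∀ d : ℕ, ∑ n ∈ (Finset.Ioc 0 ⌊H⌋₊).filter (d ∣ ·), ind n * (ArithmeticFunction.liouville n : ℝ) =
      ∑ b ∈ (chenSetB x).filter (fun b => d ∣ b), (ArithmeticFunction.liouville b : ℝ) := fun d => by
    rw [hH, twistedCongrSum_indicator_eq (chenSetB x) (chenSetB_subset_Ioc x)]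
  have hsizeq : A.size H = #(chenTriplesExt x ε) := rfl
  have hVq : A.densityProduct (primesProdBelow Y) = sieveProduct 2 Y :=
    densityProduct_chenSeqExt_eq x ε Y
  have hRq : ∑ d ∈ (Finset.range ⌈D⌉₊).filter (· ∣ primesProdBelow Y), |A.remainder d H| =
      chenRemainderExt x ε D := by
    rw [hA, hH, hY]
    exact sum_abs_remainder_chenSeqExt_eq hxpos hε hε1 D
  have hFs : B.1 (Real.log D / Real.log Y) = 2 * G / (Real.log D / Real.log Y) := by
    rw [hFeq hs0, ← upperSieveFun_one, upperSieveFun_one_eq_holds ⟨hs0, hs3⟩]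
  rw [hsift, hsizeq, hVq, hRq, hFs, hlogD] at hI
  simp only [hE] at hI
  -- the main term (verbatim from the tree)
  have hT0 : 0 ≤ (#(chenTriplesExt x ε) : ℝ) := Nat.cast_nonneg _
  have hVy0 : 0 ≤ sieveProduct 2 Y := (sieveProduct_two_mem_Icc Y).1
  have hVz0 : 0 ≤ sieveProduct 2 zr := (sieveProduct_two_mem_Icc zr).1
  have hE0 : 0 ≤ Real.exp (400 / Real.log x) := (Real.exp_pos _).le
  have hρle : 1 / 8 * Real.log x / Real.log Y ≤ 3 / 8 := by
    rw [div_le_iff₀ hlogY0]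
    nlinarith
  have hr0 : 0 ≤ ((1 / 2 - δ) * Real.log x) ^ (-(1 / 3 : ℝ)) := Real.rpow_nonneg (by positivity) _
  have hF0 : 0 ≤ 2 * G / ((1 / 2 - δ) * Real.log x / Real.log Y) := by positivity
  have hVyle : sieveProduct 2 Y ≤ sieveProduct 2 zr *
      (1 / 8 * Real.log x / Real.log Y * Real.exp (400 / Real.log x)) := by
    have h := sieveProduct_two_le_mul hzr3 hzY
    rw [hlogzr] at h
    have h50 : (50 : ℝ) / (1 / 8 * Real.log x) = 400 / Real.log x := by
      rw [div_mul_eq_div_div]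
      norm_num
    rwa [h50] at h
  have hρF : 1 / 8 * Real.log x / Real.log Y * (2 * G / ((1 / 2 - δ) * Real.log x / Real.log Y)) = K := by
    rw [hK]
    field_simp
    ring
  have hmain := sieve_mainTerm_algebra (C := CI) hT0 hVz0 hVy0 hE0 hρle hr0 hF0 hVyle hρF hfac
  -- conclude
  have hhalf := mul_le_mul_of_nonneg_left hmain (by norm_num : (0 : ℝ) ≤ 1 / 2)
  have hKθ : (1 / 2) * ((K + θ) * #(chenTriplesExt x ε) * sieveProduct 2 zr + chenRemainderExt x ε D) =
      (1 / 2) * (#(chenTriplesExt x ε) * sieveProduct 2 zr * (K + θ)) + (1 / 2) * chenRemainderExt x ε D := by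
    ring
  rw [hKθ]
  linarith [hI, hhalf]

set_option maxHeartbeats 400000 in
/-- **(C′) from the cardinality and remainder bounds of the tree and the oracle hypothesis on the
switched set.** If for every `ε, η > 0` and all large `x`,
`∑_{d ≤ x^{1/2−ε}} |∑_{b ∈ B(x), d ∣ b} λ(b)| ≤ η x/(log x)²` (the route's hypothesis HP2), then for every
`ε₀ > 0` and all large `x`, `S(B′(x), (x+3)^{1/3}) ≤ (c e^γ/4 + ε₀)(x/log x) V(x^{1/8})` — the tree's
estimate (C) `Chen.twin_sieveUpperB_holds` (Nathanson Thm 10.6 for `{p + 2}`) with the main term HALVED.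
Proof: as `Chen.twin_sieveUpperB_of` (take `ε = δ = θ = t = min(1/8, ε₀/30)` in
`roughCount_chenParityB_le`, `#T̃ ≤ (1+2t)(c+t)x/log x` by `chenTriplesExt_card_bound`,
`R ≤ Cx/(log x)³` by `chenRemainderExt_bound`), plus the oracle remainder `≤ ½ t X V`. -/
theorem parity_twin_sieveUpperB
    (hΛ : ∀ ε : ℝ, 0 < ε → ∀ η : ℝ, 0 < η → ∀ᶠ x : ℕ in atTop,
      (∑ d ∈ Finset.Icc 1 ⌊(x : ℝ) ^ (1 / 2 - ε)⌋₊,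
        |∑ b ∈ (chenSetB x).filter (fun b => d ∣ b), (ArithmeticFunction.liouville b : ℝ)|) ≤
          η * (x : ℝ) / Real.log x ^ 2) :
    ∀ ε : ℝ, 0 < ε → ∀ᶠ x : ℕ in atTop,
      (roughCount ((chenSetB x).filter fun n => ArithmeticFunction.liouville n = -1) (twinY x) : ℝ) ≤
        (switchingConstant * Real.exp Real.eulerMascheroniConstant / 4 + ε) * twinMainTerm x := by
  intro ε₀ hε₀
  set G := Real.exp Real.eulerMascheroniConstant with hG
  set c := switchingConstant with hc
  have hc0 : 0 ≤ c := switchingConstant_nonneg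
  have hc2 : c ≤ 2 := switchingConstant_le_two
  have hG0 : 0 < G := Real.exp_pos _
  have hG3 : G ≤ 3 := by
    have h1 : G ≤ Real.exp 1 :=
      Real.exp_le_exp.mpr (Real.eulerMascheroniConstant_lt_two_thirds.le.trans (by norm_num))
    have h2 := Real.exp_one_lt_d9
    linarith
  set t := min (1 / 8) (ε₀ / 30) with ht
  have ht0 : 0 < t := lt_min (by norm_num) (by positivity)
  have ht8 : t ≤ 1 / 8 := min_le_left _ _
  have ht30 : 30 * t ≤ ε₀ := by
    have := min_le_right (1 / 8 : ℝ) (ε₀ / 30)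
    rw [← ht] at this
    linarith
  have ht1 : t ≤ 1 := by linarith
  have hS := roughCount_chenParityB_le (ε := t) (δ := t) (θ := t) ht0 ht1 ht0 ht8 ht0
  have hT := chenTriplesExt_card_bound t ht0 ht1 t ht0
  obtain ⟨C, hR⟩ := chenRemainderExt_bound t ht0 ht1 t ht0
  set c₀ := 16 * Real.exp (-7) with hc₀
  have hc₀0 : 0 < c₀ := by positivity
  have hO := hΛ t ht0 (t * c₀) (by positivity)
  have hjunk : ∀ᶠ x : ℕ in atTop, max C 0 * x / Real.log x ^ 3 ≤
      t * (16 * Real.exp (-7) * x / Real.log x ^ 2) := by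
    have hpos : 0 < t * (16 * Real.exp (-7)) := by positivity
    filter_upwards [(Real.tendsto_log_atTop.comp tendsto_natCast_atTop_atTop).eventually_ge_atTop
      (max C 0 / (t * (16 * Real.exp (-7)))), eventually_gt_atTop 1] with x hx hx1
    have hx1' : (1 : ℝ) < x := by exact_mod_cast hx1
    have hx0 : (0 : ℝ) < x := by linarith
    have hlog : 0 < Real.log x := Real.log_pos hx1'
    have hx' : max C 0 / (t * (16 * Real.exp (-7))) ≤ Real.log x := hx
    rw [div_le_iff₀ hpos] at hx'
    have hL : 0 < (x : ℝ) / Real.log x ^ 3 := by positivity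
    calc max C 0 * x / Real.log x ^ 3 = max C 0 * ((x : ℝ) / Real.log x ^ 3) := by ring
      _ ≤ Real.log x * (t * (16 * Real.exp (-7))) * ((x : ℝ) / Real.log x ^ 3) :=
          mul_le_mul_of_nonneg_right hx' hL.le
      _ = t * (16 * Real.exp (-7) * x / Real.log x ^ 2) := by
          field_simp
  filter_upwards [hS, hT, hR, hjunk, eventually_ge_atTop 6561, hO] with x hSx hTx hRx hjx hx hOx
  have hx1 : (1 : ℝ) < x := by exact_mod_cast (show 1 < x by omega)
  have hx0 : (0 : ℝ) < x := by linarith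
  have hlog : 0 < Real.log x := Real.log_pos hx1
  have hM := twinMainTerm_ge hx
  have hM0 := twinMainTerm_nonneg x
  have hV0 : 0 ≤ sieveProduct 2 ((x : ℝ) ^ (1 / 8 : ℝ)) := (sieveProduct_two_mem_Icc _).1
  set T : ℝ := (#(chenTriplesExt x t) : ℝ) with hTdef
  have hT0 : 0 ≤ T := Nat.cast_nonneg _
  -- `T V ≤ (1+2t)(c+t) X V`
  have h1 : T * sieveProduct 2 ((x : ℝ) ^ (1 / 8 : ℝ)) ≤ (1 + 2 * t) * (c + t) * twinMainTerm x := by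
    rw [twinMainTerm]
    calc T * sieveProduct 2 ((x : ℝ) ^ (1 / 8 : ℝ))
        ≤ ((1 + 2 * t) * (c + t) * x / Real.log x) * sieveProduct 2 ((x : ℝ) ^ (1 / 8 : ℝ)) :=
          mul_le_mul_of_nonneg_right hTx hV0
      _ = (1 + 2 * t) * (c + t) * ((x : ℝ) / Real.log x * sieveProduct 2 ((x : ℝ) ^ (1 / 8 : ℝ))) := by
          ring
  -- `R ≤ t X V`
  have h2 : chenRemainderExt x t ((x : ℝ) ^ (1 / 2 - t)) ≤ t * twinMainTerm x := by
    have hCle : C * x / Real.log x ^ 3 ≤ max C 0 * x / Real.log x ^ 3 := by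
      have : 0 ≤ (x : ℝ) / Real.log x ^ 3 := by positivity
      calc C * x / Real.log x ^ 3 = C * ((x : ℝ) / Real.log x ^ 3) := by ring
        _ ≤ max C 0 * ((x : ℝ) / Real.log x ^ 3) := mul_le_mul_of_nonneg_right (le_max_left _ _) this
        _ = max C 0 * x / Real.log x ^ 3 := by ring
    exact hRx.trans (hCle.trans (hjx.trans (mul_le_mul_of_nonneg_left hM ht0.le)))
  -- the oracle remainder `≤ t X V`
  have h3 : ∑ d ∈ (Finset.range ⌈(x : ℝ) ^ (1 / 2 - t)⌉₊).filter (· ∣ primesProdBelow (twinY x : ℝ)),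
      |∑ b ∈ (chenSetB x).filter (fun b => d ∣ b), (ArithmeticFunction.liouville b : ℝ)| ≤
      t * twinMainTerm x := by
    refine (sum_range_filter_dvd_le_sum_Icc (fun d => abs_nonneg _) _).trans (hOx.trans ?_)
    calc t * c₀ * (x : ℝ) / Real.log x ^ 2 = t * (16 * Real.exp (-7) * x / Real.log x ^ 2) := by
          rw [hc₀]; ring
      _ ≤ t * twinMainTerm x := mul_le_mul_of_nonneg_left hM ht0.le
  -- the constant
  have hKt : G / (2 * (1 - 2 * t)) ≤ G / 2 * (1 + 4 * t) := by
    rw [div_le_iff₀ (by linarith)]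
    have h14 : (0 : ℝ) ≤ 1 - 4 * t := by linarith
    nlinarith [mul_nonneg (mul_nonneg hG0.le ht0.le) h14]
  have hK0 : 0 ≤ G / (2 * (1 - 2 * t)) + t := by
    have : 0 < 2 * (1 - 2 * t) := by linarith
    positivity
  have hstep1 : (1 + 2 * t) * (c + t) ≤ c + 6 * t := by nlinarith
  have hstep2 : G / (2 * (1 - 2 * t)) + t ≤ G / 2 + 7 * t := by nlinarith
  have hstep3 : (G / 2 + 7 * t) * (c + 6 * t) ≤ c * G / 2 + 29 * t := by nlinarith
  have hΦ : (G / (2 * (1 - 2 * t)) + t) * ((1 + 2 * t) * (c + t)) + t ≤ c * G / 2 + 30 * t := by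
    have hA : 0 ≤ (1 + 2 * t) * (c + t) := by positivity
    have := mul_le_mul hstep2 hstep1 hA (by positivity)
    linarith
  have hmid : (G / (2 * (1 - 2 * t)) + t) * T * sieveProduct 2 ((x : ℝ) ^ (1 / 8 : ℝ)) +
      chenRemainderExt x t ((x : ℝ) ^ (1 / 2 - t)) ≤ (c * G / 2 + 30 * t) * twinMainTerm x := by
    calc _ ≤ (G / (2 * (1 - 2 * t)) + t) * ((1 + 2 * t) * (c + t) * twinMainTerm x) +
          t * twinMainTerm x := by
          have h4 : (G / (2 * (1 - 2 * t)) + t) * T * sieveProduct 2 ((x : ℝ) ^ (1 / 8 : ℝ)) =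
              (G / (2 * (1 - 2 * t)) + t) * (T * sieveProduct 2 ((x : ℝ) ^ (1 / 8 : ℝ))) := by ring
          rw [h4]
          exact add_le_add (mul_le_mul_of_nonneg_left h1 hK0) h2
      _ = ((G / (2 * (1 - 2 * t)) + t) * ((1 + 2 * t) * (c + t)) + t) * twinMainTerm x := by ring
      _ ≤ (c * G / 2 + 30 * t) * twinMainTerm x := mul_le_mul_of_nonneg_right hΦ hM0
  calc (roughCount ((chenSetB x).filter fun n => ArithmeticFunction.liouville n = -1) (twinY x) : ℝ)
      ≤ (1 / 2) * ((G / (2 * (1 - 2 * t)) + t) * T * sieveProduct 2 ((x : ℝ) ^ (1 / 8 : ℝ)) +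
          chenRemainderExt x t ((x : ℝ) ^ (1 / 2 - t))) +
        (1 / 2) * ∑ d ∈ (Finset.range ⌈(x : ℝ) ^ (1 / 2 - t)⌉₊).filter
            (· ∣ primesProdBelow (twinY x : ℝ)),
          |∑ b ∈ (chenSetB x).filter (fun b => d ∣ b), (ArithmeticFunction.liouville b : ℝ)| := hSx
    _ ≤ (1 / 2) * ((c * G / 2 + 30 * t) * twinMainTerm x) + (1 / 2) * (t * twinMainTerm x) := by
        gcongr
    _ = (c * G / 4 + 31 * t / 2) * twinMainTerm x := by ring
    _ ≤ (c * G / 4 + ε₀) * twinMainTerm x := by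
        refine mul_le_mul_of_nonneg_right ?_ hM0
        linarith

end Summit.Parity.GeneralizedHardyLittlewood.Theorems
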